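import Literature.NumberTheory.DiophantineGeometry.SchurWeylPlethysm
import HarnessLib

/-!
# Schur functors applied to a representation: `S_μ(W) = c_μ · W^{⊗d}` for a `G`-module `W`

Weyl's construction of the tree's `weylModule k σ μ = c_μ · (k^σ)^{⊗d}`
(`Literature/NumberTheory/DiophantineGeometry/SchurWeylPlethysm.lean`) is stated there only for
the standard column representation `k^σ` of `GL σ k`. The plethysms `Sym^n Sym^m V`,
`Λ^n Sym^m V`, … of Fischer–Ikenmeyer 2020 (§2: "Given any `GL(V)`-representation `W` (for example
`W = V`), there is a natural linear `GL(V)`-action on its `m`-th tensor power `⊗^m W` … We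
define `S^ν W` to be the image of the Schur functor", with `Sym^m V = S^{(m)} V`,
`Λ^m V = S^{(1^m)} V`, "A plethysm is the application of `S^μ` to `S^ν V`") need the same
construction for an ARBITRARY representation `ρ : Representation k G W`:

* `toLinearEquivHom ρ : G →* (W ≃ₗ[k] W)` and the diagonal action
  `tensorDiagRep ρ d : Representation k G (W^{⊗d})`, `g · (w₀ ⊗ ⋯ ⊗ w_{d-1}) = ρ g w₀ ⊗ ⋯ ⊗
  ρ g w_{d-1}` (the tree's `diagTensorRep k W d` composed with `ρ`), commuting with the tree's
  `permTensorRep k W d` (`permTensorRep_comp_tensorDiagRep`);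
* `schurModule k W μ = c_μ · W^{⊗d} ⊆ W^{⊗d}`, the image of the Young symmetrizer
  `youngSymmetrizer k μ` (`SymmetricGroupReps.lean`) — literally the tree's `weylModule` with
  `k^σ` replaced by `W` (`schurModule_eq_weylModule : schurModule k (σ → k) μ = weylModule k σ μ`
  is `rfl`) — and the representation `schurRep ρ μ` of `G` on it (`G`-stable because the two
  actions commute, `tensorDiagRep_mem_schurModule`, proved);
* the special shapes: `Nat.Partition.indiscrete m` (one row, `c_{(m)} = ∑_σ σ`, image
  `Sym^m W`) is Mathlib's; `Nat.Partition.column n` (one column `(1^n)`, `c_{(1^n)} = ∑ sgn(σ) σ`,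
  image `Λ^n W`) is defined here; `symPowerRep ρ m`, `extPowerRep ρ n` are the abbreviations;
* `stdRep σ k`, the standard column representation of `GL σ k` on `k^σ` as a `Representation`,
  with `tensorDiagRep (stdRep σ k) d = glTensorRep σ k d` (proved), so that
  `schurRep (stdRep σ k) μ` is the tree's `weylRep k σ μ` on the nose.

Everything here is definitions and `rfl`/one-line API; no classical theorem is asserted (the
identification of `schurModule` with the `μ`-isotypic image for one-row/one-column `μ`, the
dimension of `Λ^n W`, etc. are not needed for stating multiplicities via `hwMultiplicity`).
Not here: the dual plethysm coefficient `b_λ(n,m)` and the Fischer–Ikenmeyer facts (planned: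
`Literature/Computability/AlgebraicComplexity/PlethysmTomographyBounds.lean`).

## References

* [FischerIkenmeyer2020] N. Fischer, C. Ikenmeyer, *The computational complexity of plethysm
  coefficients*, Comput. Complexity 29 (2020) 8, §2 (Schur functor on a `GL(V)`-representation,
  `Sym^m`, `Λ^m`, plethysm `S^μ S^ν V`).
* [FultonHarrisGTM129] W. Fulton, J. Harris, *Representation Theory*, GTM 129, §6.1 (Weyl's
  construction `S_λ V = Im(c_λ) ⊆ V^{⊗d}` for any vector space `V`, functorial in `V`), Ex. 6.17
  (plethysm).
-/

noncomputable section

open scoped TensorProduct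

namespace Literature.RepresentationTheory.GeneralLinear

open Literature.NumberTheory.DiophantineGeometry

/-! ### One-column partitions -/

/-- The one-column partition `(1^n) = (1, 1, …, 1) ⊢ n` (its Young symmetrizer is the
antisymmetrizer `∑ sgn(σ) σ`, whose image in `W^{⊗n}` is `Λ^n W`; the one-row partition `(n)`
is Mathlib's `Nat.Partition.indiscrete n`). Declared in Mathlib's `Nat.Partition` namespace for
dot notation (deliberate extension; no such name in Mathlib at this pin). [folklore] -/
def _root_.Nat.Partition.column (n : ℕ) : Nat.Partition n :=
  Nat.Partition.ofSums n (Multiset.replicate n 1) (by simp)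

/-- The parts of `(1^n)` are `n` ones. [folklore] -/
@[simp] theorem _root_.Nat.Partition.column_parts (n : ℕ) :
    (Nat.Partition.column n).parts = Multiset.replicate n 1 := by
  have h : ∀ a ∈ Multiset.replicate n 1, a ≠ 0 := fun a ha => by
    rw [Multiset.eq_of_mem_replicate ha]; exact one_ne_zero
  simpa [Nat.Partition.column, Nat.Partition.ofSums, Multiset.filter_eq_self] using h

/-! ### The diagonal action of `G` on `W^{⊗d}` through a representation -/

section Diag

variable {k G W : Type*} [CommRing k] [Group G] [AddCommGroup W] [Module k W]

/-- A representation `ρ` of a group as a homomorphism into the linear automorphisms `W ≃ₗ[k] W`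
(Mathlib's `Representation.asGroupHom` followed by `LinearMap.GeneralLinearGroup.generalLinearEquiv`).
[folklore] -/
def toLinearEquivHom (ρ : Representation k G W) : G →* (W ≃ₗ[k] W) :=
  (LinearMap.GeneralLinearGroup.generalLinearEquiv k W).toMonoidHom.comp ρ.asGroupHom

/-- `toLinearEquivHom ρ g` acts as `ρ g`. [folklore] -/
@[simp] theorem toLinearEquivHom_apply (ρ : Representation k G W) (g : G) (w : W) :
    toLinearEquivHom ρ g w = ρ g w := by
  change ((ρ.asGroupHom g : W →ₗ[k] W)) w = ρ g w
  rw [Representation.asGroupHom_apply]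

/-- As a linear map, `toLinearEquivHom ρ g` is `ρ g`. [folklore] -/
@[simp] theorem toLinearEquivHom_coe (ρ : Representation k G W) (g : G) :
    ((toLinearEquivHom ρ g : W ≃ₗ[k] W) : W →ₗ[k] W) = ρ g :=
  LinearMap.ext (toLinearEquivHom_apply ρ g)

/-- **The diagonal action** of `G` on the tensor power `W^{⊗d}` through `ρ`:
`g · (w₀ ⊗ ⋯ ⊗ w_{d-1}) = ρ g w₀ ⊗ ⋯ ⊗ ρ g w_{d-1}` (FI 2020 §2; Fulton–Harris §6.1), the tree's
`diagTensorRep k W d` (action of `GL(W)`) composed with `toLinearEquivHom ρ`.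
[cite: FischerIkenmeyer2020, §2 (action on ⊗^m W)] -/
def tensorDiagRep (ρ : Representation k G W) (d : ℕ) : Representation k G (TensorPower k d W) :=
  (diagTensorRep k W d).comp (toLinearEquivHom ρ)

/-- `tensorDiagRep` on a pure tensor. [cite: FischerIkenmeyer2020, §2 (action on ⊗^m W)] -/
@[simp] theorem tensorDiagRep_tprod (ρ : Representation k G W) (d : ℕ) (g : G) (v : Fin d → W) :
    tensorDiagRep ρ d g (PiTensorProduct.tprod k v) =
      PiTensorProduct.tprod k fun i => ρ g (v i) := by
  change diagTensorRep k W d (toLinearEquivHom ρ g) (PiTensorProduct.tprod k v) = _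
  rw [diagTensorRep_tprod]
  simp only [toLinearEquivHom_apply]

/-- The actions of `S_d` (the tree's `permTensorRep`) and of `G` on `W^{⊗d}` commute.
Fulton–Harris §6.1. [folklore] -/
theorem permTensorRep_comp_tensorDiagRep (ρ : Representation k G W) (d : ℕ)
    (τ : Equiv.Perm (Fin d)) (g : G) :
    permTensorRep k W d τ ∘ₗ tensorDiagRep ρ d g = tensorDiagRep ρ d g ∘ₗ permTensorRep k W d τ :=
  permTensorRep_comp_diagTensorRep k W d τ (toLinearEquivHom ρ g)

end Diag

/-! ### Schur modules `S_μ(W) = c_μ · W^{⊗d}` and the representation on them -/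

section Schur

variable (k : Type*) {G : Type*} (W : Type*) [Field k] [Group G] [AddCommGroup W] [Module k W]
  {d : ℕ}

/-- **Weyl's construction for an arbitrary space.** The Schur module
`S_μ(W) = c_μ · W^{⊗d} ⊆ W^{⊗d}` of a partition `μ ⊢ d`: the image of the Young symmetrizer
`c_μ ∈ k[S_d]` acting through `permTensorRep` (for `W = k^σ` this is the tree's `weylModule`,
see `schurModule_eq_weylModule`). Fulton–Harris §6.1; FI 2020 §2 ("the image of the Schur
functor"). [cite: FultonHarrisGTM129, §6.1 (Weyl's construction)] -/
def schurModule (μ : Nat.Partition d) : Submodule k (TensorPower k d W) :=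
  LinearMap.range ((permTensorRep k W d).asAlgebraHom (youngSymmetrizer k μ))

/-- `schurModule` specialises to the tree's `weylModule` for the standard space `k^σ`
(definitionally). [folklore] -/
theorem schurModule_eq_weylModule (σ : Type*) [Fintype σ] [LinearOrder σ] (μ : Nat.Partition d) :
    schurModule k (σ → k) μ = weylModule k σ μ :=
  rfl

variable {k W}

/-- The action of the group algebra `k[S_d]` on `W^{⊗d}` commutes with the diagonal action of
`G` (from `permTensorRep_comp_tensorDiagRep` by linearity). Fulton–Harris Lemma 6.22. [folklore] -/
theorem asAlgebraHom_permTensorRep_comp_tensorDiagRep (ρ : Representation k G W)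
    (a : MonoidAlgebra k (Equiv.Perm (Fin d))) (g : G) :
    (permTensorRep k W d).asAlgebraHom a ∘ₗ tensorDiagRep ρ d g =
      tensorDiagRep ρ d g ∘ₗ (permTensorRep k W d).asAlgebraHom a := by
  induction a using MonoidAlgebra.induction_on with
  | hM τ =>
    rw [Representation.asAlgebraHom_of]
    exact permTensorRep_comp_tensorDiagRep ρ d τ g
  | hadd a b ha hb => rw [map_add, LinearMap.add_comp, LinearMap.comp_add, ha, hb]
  | hsmul r a ha => rw [map_smul, LinearMap.smul_comp, LinearMap.comp_smul, ha]

/-- The Schur module is stable under the diagonal action of `G` (the two actions commute).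
Fulton–Harris §6.1, Lemma 6.22. [folklore] -/
theorem tensorDiagRep_mem_schurModule (ρ : Representation k G W) (μ : Nat.Partition d) (g : G)
    {x : TensorPower k d W} (hx : x ∈ schurModule k W μ) :
    tensorDiagRep ρ d g x ∈ schurModule k W μ := by
  obtain ⟨y, rfl⟩ := hx
  refine ⟨tensorDiagRep ρ d g y, ?_⟩
  change ((permTensorRep k W d).asAlgebraHom _ ∘ₗ tensorDiagRep ρ d g) y = _
  rw [asAlgebraHom_permTensorRep_comp_tensorDiagRep]
  rfl

/-- **The Schur functor applied to a representation**: the representation `S_μ(ρ)` of `G` on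
`S_μ(W) = c_μ · W^{⊗d}`, the restriction of the diagonal action (Mathlib
`Representation.subrepresentation`, stability `tensorDiagRep_mem_schurModule`). For
`ρ = stdRep σ k` this is the tree's `weylRep k σ μ`. FI 2020 §2; Fulton–Harris §6.1.
[cite: FischerIkenmeyer2020, §2 (Schur functor S^ν W)] -/
def schurRep (ρ : Representation k G W) (μ : Nat.Partition d) :
    Representation k G (schurModule k W μ) :=
  (tensorDiagRep ρ d).subrepresentation (schurModule k W μ) fun g _ hx =>
    tensorDiagRep_mem_schurModule ρ μ g hx

/-- `schurRep` acts as the diagonal action on the underlying tensors. [folklore] -/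
@[simp] theorem coe_schurRep_apply (ρ : Representation k G W) (μ : Nat.Partition d) (g : G)
    (x : schurModule k W μ) :
    ((schurRep ρ μ g x : schurModule k W μ) : TensorPower k d W) = tensorDiagRep ρ d g x :=
  rfl

/-- **Symmetric powers of a representation**: `Sym^m ρ = S_{(m)}(ρ)` on
`Sym^m W = c_{(m)} · W^{⊗m}` (one-row shape, Mathlib's `Nat.Partition.indiscrete m`).
[cite: FischerIkenmeyer2020, §2 (Sym^m V = S^ν V, ν = (m))] -/
abbrev symPowerRep (ρ : Representation k G W) (m : ℕ) :
    Representation k G (schurModule k W (Nat.Partition.indiscrete m)) :=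
  schurRep ρ (Nat.Partition.indiscrete m)

/-- **Exterior powers of a representation**: `Λ^n ρ = S_{(1^n)}(ρ)` on
`Λ^n W = c_{(1^n)} · W^{⊗n}` (one-column shape `Nat.Partition.column n`).
[cite: FischerIkenmeyer2020, §2 (Λ^m V = S^ν V, ν = (1,…,1))] -/
abbrev extPowerRep (ρ : Representation k G W) (n : ℕ) :
    Representation k G (schurModule k W (Nat.Partition.column n)) :=
  schurRep ρ (Nat.Partition.column n)

end Schur

/-! ### The standard representation of `GL σ k` and consistency with `glTensorRep` / `weylRep` -/

section Std

variable (σ k : Type*) [Fintype σ] [DecidableEq σ] [CommRing k]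

/-- The standard (column) representation of `GL σ k` on `k^σ`, `g · v = g *ᵥ v` (Mathlib's
`Matrix.GeneralLinearGroup.toLin` and `LinearMap.GeneralLinearGroup.generalLinearEquiv`, then the
coercion to linear maps) — the same convention as the tree's `glTensorRep` and `linSubst`.
Fulton–Harris §15.1. [folklore] -/
def stdRep : Representation k (GL σ k) (σ → k) :=
  (LinearEquiv.automorphismGroup.toLinearMapMonoidHom (R := k) (M := σ → k)).comp
    ((LinearMap.GeneralLinearGroup.generalLinearEquiv k (σ → k)).toMonoidHom.comp
      (Matrix.GeneralLinearGroup.toLin (n := σ) (R := k)).toMonoidHom)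

/-- The standard representation is matrix-times-column-vector. [folklore] -/
@[simp] theorem stdRep_apply (g : GL σ k) (v : σ → k) :
    stdRep σ k g v = (g : Matrix σ σ k).mulVec v :=
  rfl

end Std

section StdConsistency

variable (σ k : Type*) [Fintype σ] [DecidableEq σ] [CommRing k]

/-- `toLinearEquivHom (stdRep σ k)` is `generalLinearEquiv ∘ toLin` (both send `g` to the
automorphism `v ↦ g *ᵥ v`). [folklore] -/
theorem toLinearEquivHom_stdRep :
    toLinearEquivHom (stdRep σ k) =
      (LinearMap.GeneralLinearGroup.generalLinearEquiv k (σ → k)).toMonoidHom.comp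
        (Matrix.GeneralLinearGroup.toLin (n := σ) (R := k)).toMonoidHom := by
  refine MonoidHom.ext fun g => LinearEquiv.ext fun v => ?_
  rw [toLinearEquivHom_apply, stdRep_apply]
  rfl

/-- **Consistency**: the diagonal action of `GL σ k` on `(k^σ)^{⊗d}` through the standard
representation is the tree's `glTensorRep σ k d`. [folklore] -/
theorem tensorDiagRep_stdRep (d : ℕ) : tensorDiagRep (stdRep σ k) d = glTensorRep σ k d := by
  change (diagTensorRep k (σ → k) d).comp (toLinearEquivHom (stdRep σ k)) = _
  rw [toLinearEquivHom_stdRep]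
  rfl

end StdConsistency

section WeylConsistency

variable (σ k : Type*) [Fintype σ] [LinearOrder σ] [Field k] {d : ℕ}

/-- **Consistency**: on `S_μ(k^σ) = weylModule k σ μ` the Schur representation of the standard
representation acts exactly as the tree's `weylRep k σ μ` (same carrier by
`schurModule_eq_weylModule`, same action by `tensorDiagRep_stdRep`). [folklore] -/
theorem coe_schurRep_stdRep_apply (μ : Nat.Partition d) (g : GL σ k) (x : schurModule k (σ → k) μ) :
    ((schurRep (stdRep σ k) μ g x : schurModule k (σ → k) μ) : TensorPower k d (σ → k)) =
      ((weylRep k σ μ g x : weylModule k σ μ) : TensorPower k d (σ → k)) := by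
  rw [coe_schurRep_apply, coe_weylRep_apply, tensorDiagRep_stdRep]

end WeylConsistency

end Literature.RepresentationTheory.GeneralLinear
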